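import Mathlib
import HarnessLib
import Summits.Ventures.LatticeQCDFlow.Scoring.ChainHoeffding
import Summits.Ventures.LatticeQCDFlow.Scoring.DoeblinSkeleton

/-!
# Hoeffding from a Poisson solution, and for an `m`-step (block) Doeblin certificate:
# `P(|A_N − πf| ≥ s) ≤ 2 exp(−(Ns − 4mC'/ε)²/(8 N m² C'²/ε²))` from ANY start

HONEST FRAMING: exact (Metropolis-corrected) sampling algorithms for lattice gauge theory;
figures of merit are autocorrelation/cost numbers at stated couplings and volumes; no
continuum-physics claim.

Venture `LatticeQCDFlow` (cell pub-lqcd), topic `Scoring`; FANOUT row 8 (`s0-cpn-nemc`, GEN-13).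
NEW WORK of the cell, not a published result; no definition is introduced.  `Scoring/ChainHoeffding.lean`
proves Gaussian tails under a ONE-step minorisation; a sweep, a trajectory family or an interleaved
scheme is usually certified per BLOCK of `m` updates (`Scoring/DoeblinSkeleton.lean`).  This file
separates the two ingredients — (i) a bounded solution `h` of the Poisson equation `h − Kh = f − c`
gives the Gaussian tail `exp(−(Ns − 2‖h‖)²/(2N‖h‖²))` for the time average of `f` about `c`, for
ANY Markov kernel and ANY start (no invariance needed); (ii) an `m`-step Doeblin constant gives such
an `h` with `‖h‖ ≤ 2mC'/ε` (Neumann series with the skeleton sup-norm decay `(1 − ε/2)^{⌊t/m⌋}`) —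
and composes them.  Inputs: `chain_martingale_tail_le` (parent), `abs_iterate_kop_le_of_doeblin`
(`Scoring/DoeblinGreenKubo.lean`) applied to the skeleton kernel `nHit κ m`
(`iterate_kop_nHit`, `invariant_nHit`, `summable_pow_div`, `tsum_pow_div_le`).  Printed counterpart
NAMED ONLY: Glynn–Ormoneit 2002 (the `m`-step form is theirs); nothing is cited as a fact.

## Content

* **`poisson_exists_of_decay`** — any Markov `κ`, bounded measurable `f` with a summable sup-norm
  envelope `|(kop κ)^[t] f| ≤ a_t`: `h = Σ_t (kop κ)^[t] f` is measurable, `|h| ≤ Σ_t a_t`, `h − Kh = f`;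
* **`chain_tail_le_exp_of_poisson`**, `chain_abs_tail_le_exp_of_poisson` — any Markov `κ`, any
  start: a bounded measurable `h` (`|h| ≤ B`) with `h − Kh = f − c` gives, for `N ≥ 1`, `Ns ≥ 2B`:
  `P_{μ₀}((1/N) Σ_{i<N} f(X_i) − c ≥ s) ≤ exp(−(Ns − 2B)²/(2NB²))` (two-sided: factor `2`);
* `abs_iterate_kop_le_of_doeblin_nHit` — `(nHit κ m) ≥ επ`, `f` centred, `|f| ≤ C` ⇒
  `|(kop κ)^[t] f| ≤ (1 − ε/2)^{⌊t/m⌋} C`; **`poisson_exists_of_doeblin_nHit`** — `|h| ≤ 2mC/ε`;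
* **`chain_abs_tail_le_exp_of_doeblin_nHit`** — `π` invariant, `(nHit κ m)(x, ·) ≥ ε π` (`ε > 0`,
  `m ≥ 1`), `|f| ≤ C`, `C' = C + |πf|`, any start, `N ≥ 1`, `Ns ≥ 4mC'/ε`:
  `P_{μ₀}(|(1/N) Σ_{i<N} f(X_i) − πf| ≥ s) ≤ 2 exp(−(Ns − 4mC'/ε)²/(8 N m² C'²/ε²))`.

Reading (value-free): a block certificate costs the factor `m` inside the burn-in offset and the
factor `m²` inside the Gaussian rate, in single-update units — the same exchange rate as the
`m`-skeleton error bar.  NOT CLAIMED: any `ε_m`, `m` for a concrete sampler; sharpness.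
-/

noncomputable section

namespace Summit.Ventures.LatticeQCDFlow.Scoring

open MeasureTheory ProbabilityTheory Filter Finset Preorder Summit.Ventures.LatticeQCDFlow.Exactness
open scoped ENNReal NNReal Topology

variable {Ω : Type*} [MeasurableSpace Ω]

/-! ### A Poisson solution from any summable sup-norm envelope -/

section Poisson

variable {κ : Kernel Ω Ω} [IsMarkovKernel κ]

/-- **Neumann-series Poisson solution.**  For a Markov kernel `κ` and a bounded measurable `f` whose
iterates have a summable sup-norm envelope `|(kop κ)^[t] f x| ≤ a t`, the function
`h = Σ_t (kop κ)^[t] f` is measurable, bounded by `Σ_t a_t`, and solves `h − kop κ h = f`. -/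
theorem poisson_exists_of_decay {f : Ω → ℝ} (hf : Measurable f) {C : ℝ} (hC : ∀ x, |f x| ≤ C)
    {a : ℕ → ℝ} (ha : Summable a) (hdecay : ∀ t x, |(kop κ)^[t] f x| ≤ a t) :
    ∃ h : Ω → ℝ, Measurable h ∧ (∀ x, |h x| ≤ ∑' t, a t) ∧ ∀ x, h x - kop κ h x = f x := by
  have hsum : ∀ x, Summable fun t => (kop κ)^[t] f x := fun x =>
    Summable.of_norm_bounded ha fun t => by rw [Real.norm_eq_abs]; exact hdecay t x
  set S : ℕ → Ω → ℝ := fun N x => ∑ t ∈ Finset.range N, (kop κ)^[t] f x with hS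
  have hSm : ∀ N, Measurable (S N) := fun N =>
    Finset.measurable_sum _ fun t _ => (iterate_kop_bounded_measurable κ hf hC t).1
  have hSb : ∀ N x, |S N x| ≤ ∑' t, a t := by
    intro N x
    calc |S N x| ≤ ∑ t ∈ Finset.range N, |(kop κ)^[t] f x| := Finset.abs_sum_le_sum_abs _ _
      _ ≤ ∑ t ∈ Finset.range N, a t := Finset.sum_le_sum fun t _ => hdecay t x
      _ ≤ ∑' t, a t :=
          sum_le_hasSum _ (fun t _ => (abs_nonneg _).trans (hdecay t x)) ha.hasSum
  have hlim : ∀ x, Tendsto (fun N => S N x) atTop (𝓝 (∑' t, (kop κ)^[t] f x)) := fun x =>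
    (hsum x).hasSum.tendsto_sum_nat
  refine ⟨fun x => ∑' t, (kop κ)^[t] f x, ?_, ?_, fun x => ?_⟩
  · exact measurable_of_tendsto_metrizable hSm (tendsto_pi_nhds.2 hlim)
  · intro x
    have h1 := tsum_of_norm_bounded ha.hasSum fun t => by rw [Real.norm_eq_abs]; exact hdecay t x
    rwa [Real.norm_eq_abs] at h1
  · have hrec : ∀ N, S (N + 1) x = f x + kop κ (S N) x := by
      intro N
      have hlin : kop κ (S N) x = ∑ t ∈ Finset.range N, (kop κ)^[t + 1] f x := by
        show ∫ y, (∑ t ∈ Finset.range N, (kop κ)^[t] f y) ∂(κ x) = _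
        rw [integral_finsetSum _ fun t _ => ?_]
        · refine Finset.sum_congr rfl fun t _ => ?_
          rw [Function.iterate_succ_apply']
          rfl
        · obtain ⟨hm, hb⟩ := iterate_kop_bounded_measurable κ hf hC t
          exact integrable_of_bounded _ hm hb
      rw [hlin]
      show ∑ t ∈ Finset.range (N + 1), (kop κ)^[t] f x = _
      rw [Finset.sum_range_succ']
      simp only [Function.iterate_zero, id_eq]
      ring
    have hdct : Tendsto (fun N => kop κ (S N) x) atTop
        (𝓝 (kop κ (fun y => ∑' t, (kop κ)^[t] f y) x)) := by
      unfold kop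
      refine tendsto_integral_of_dominated_convergence (fun _ => ∑' t, a t)
        (fun N => (hSm N).aestronglyMeasurable) (integrable_const _) (fun N => ae_of_all _ fun y => ?_)
        (ae_of_all _ fun y => hlim y)
      rw [Real.norm_eq_abs]
      exact hSb N y
    have hlim1 : Tendsto (fun N => S (N + 1) x) atTop (𝓝 (∑' t, (kop κ)^[t] f x)) :=
      (hlim x).comp (tendsto_add_atTop_nat 1)
    have hlim2 : Tendsto (fun N => S (N + 1) x) atTop
        (𝓝 (f x + kop κ (fun y => ∑' t, (kop κ)^[t] f y) x)) := by
      have := hdct.const_add (f x)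
      exact this.congr fun N => (hrec N).symm
    have heq := tendsto_nhds_unique hlim1 hlim2
    linarith

end Poisson

/-! ### Gaussian tails from a bounded Poisson solution — any kernel, any start -/

section Tail

variable (κ : Kernel Ω Ω) [IsMarkovKernel κ] (μ₀ : Measure Ω) [IsProbabilityMeasure μ₀]

/-- **Hoeffding from a Poisson solution.**  For ANY Markov kernel `κ`, any initial law, a bounded
measurable `f`, a constant `c` and a bounded measurable `h` (`|h| ≤ B`) with `h − kop κ h = f − c`:
for `N ≥ 1` and `N s ≥ 2B`, `P_{μ₀}((1/N) Σ_{i<N} f(X_i) − c ≥ s) ≤ exp(−(Ns − 2B)²/(2NB²))`. -/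
theorem chain_tail_le_exp_of_poisson {f h : Ω → ℝ} {c B : ℝ} (hh : Measurable h)
    (hhb : ∀ x, |h x| ≤ B) (hpois : ∀ x, h x - kop κ h x = f x - c) {N : ℕ} (hN : N ≠ 0) {s : ℝ}
    (hs : 2 * B ≤ N * s) :
    (Kernel.trajMeasure (X := fun _ : ℕ => Ω) μ₀
          (fun m : ℕ => κ.comap (fun y : (i : ↥(Finset.Iic m)) → Ω => y ⟨m, Finset.mem_Iic.2 le_rfl⟩)
            (measurable_pi_apply _))).real
        {x | s ≤ (∑ i ∈ Finset.range N, f (x i)) / N - c}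
      ≤ Real.exp (-(N * s - 2 * B) ^ 2 / (2 * N * B ^ 2)) := by
  set P := Kernel.trajMeasure (X := fun _ : ℕ => Ω) μ₀
      (fun m : ℕ => κ.comap (fun y : (i : ↥(Finset.Iic m)) → Ω => y ⟨m, Finset.mem_Iic.2 le_rfl⟩)
        (measurable_pi_apply _)) with hP
  have hKb : ∀ x, |kop κ h x| ≤ B := abs_kop_le κ hhb
  obtain ⟨n, rfl⟩ : ∃ n, N = n + 1 := Nat.exists_eq_succ_of_ne_zero hN
  have htel : ∀ x : ℕ → Ω, ∑ i ∈ Finset.range (n + 1), (f (x i) - c)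
      = ∑ i ∈ Finset.range n, (h (x (i + 1)) - kop κ h (x i)) + h (x 0) - kop κ h (x n) := fun x => by
    have hre : ∀ i, f (x i) - c = h (x i) - kop κ h (x i) := fun i => (hpois (x i)).symm
    simp_rw [hre]
    rw [Finset.sum_sub_distrib, Finset.sum_sub_distrib, Finset.sum_range_succ' (fun i => h (x i)),
      Finset.sum_range_succ (fun i => kop κ h (x i))]
    ring
  have hNpos : (0 : ℝ) < (n + 1 : ℕ) := by exact_mod_cast Nat.succ_pos n
  have hsub : {x : ℕ → Ω | s ≤ (∑ i ∈ Finset.range (n + 1), f (x i)) / (n + 1 : ℕ) - c}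
      ⊆ {x | (n + 1 : ℕ) * s - 2 * B ≤ ∑ i ∈ Finset.range n, (h (x (i + 1)) - kop κ h (x i))} := by
    intro x hx
    simp only [Set.mem_setOf_eq] at hx ⊢
    have h1 : (∑ i ∈ Finset.range (n + 1), f (x i)) / (n + 1 : ℕ) - c
        = (∑ i ∈ Finset.range (n + 1), (f (x i) - c)) / (n + 1 : ℕ) := by
      rw [Finset.sum_sub_distrib, Finset.sum_const, Finset.card_range, nsmul_eq_mul]
      field_simp
    rw [h1, htel x, le_div_iff₀ hNpos] at hx
    have h2 : h (x 0) - kop κ h (x n) ≤ 2 * B := by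
      linarith [(abs_le.1 (hhb (x 0))).2, (abs_le.1 (hKb (x n))).1]
    linarith
  have hu : 0 ≤ ((n + 1 : ℕ) : ℝ) * s - 2 * B := by linarith
  have htail := chain_martingale_tail_le κ μ₀ hh hhb n hu
  rw [← hP] at htail
  calc P.real {x | s ≤ (∑ i ∈ Finset.range (n + 1), f (x i)) / (n + 1 : ℕ) - c}
      ≤ P.real {x | (n + 1 : ℕ) * s - 2 * B ≤ ∑ i ∈ Finset.range n, (h (x (i + 1)) - kop κ h (x i))} :=
        measureReal_mono hsub
    _ ≤ Real.exp (-(((n + 1 : ℕ) : ℝ) * s - 2 * B) ^ 2 / (2 * ((n + 1) * B ^ 2))) := htail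
    _ = Real.exp (-(((n + 1 : ℕ) : ℝ) * s - 2 * B) ^ 2 / (2 * ((n + 1 : ℕ) : ℝ) * B ^ 2)) := by
        push_cast; ring_nf

/-- **Two-sided**: under the same hypotheses,
`P_{μ₀}(|(1/N) Σ_{i<N} f(X_i) − c| ≥ s) ≤ 2 exp(−(Ns − 2B)²/(2NB²))`. -/
theorem chain_abs_tail_le_exp_of_poisson {f h : Ω → ℝ} {c B : ℝ} (hh : Measurable h)
    (hhb : ∀ x, |h x| ≤ B) (hpois : ∀ x, h x - kop κ h x = f x - c) {N : ℕ} (hN : N ≠ 0) {s : ℝ}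
    (hs : 2 * B ≤ N * s) :
    (Kernel.trajMeasure (X := fun _ : ℕ => Ω) μ₀
          (fun m : ℕ => κ.comap (fun y : (i : ↥(Finset.Iic m)) → Ω => y ⟨m, Finset.mem_Iic.2 le_rfl⟩)
            (measurable_pi_apply _))).real
        {x | s ≤ |(∑ i ∈ Finset.range N, f (x i)) / N - c|}
      ≤ 2 * Real.exp (-(N * s - 2 * B) ^ 2 / (2 * N * B ^ 2)) := by
  set P := Kernel.trajMeasure (X := fun _ : ℕ => Ω) μ₀
      (fun m : ℕ => κ.comap (fun y : (i : ↥(Finset.Iic m)) → Ω => y ⟨m, Finset.mem_Iic.2 le_rfl⟩)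
        (measurable_pi_apply _)) with hP
  have hup := chain_tail_le_exp_of_poisson κ μ₀ hh hhb hpois hN hs
  rw [← hP] at hup
  -- the lower tail from `−h`, `−f`, `−c`
  have hKlin : ∀ x, kop κ (fun z => -h z) x = -kop κ h x := fun x => by
    unfold kop; exact integral_neg _
  have hpois' : ∀ x, (fun z => -h z) x - kop κ (fun z => -h z) x = (fun z => -f z) x - (-c) :=
    fun x => by simp only [hKlin]; linarith [hpois x]
  have hhb' : ∀ x, |(fun z => -h z) x| ≤ B := fun x => by simp only [abs_neg]; exact hhb x
  have hlow := chain_tail_le_exp_of_poisson κ μ₀ (f := fun z => -f z) hh.neg hhb' hpois' hN hs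
  rw [← hP] at hlow
  have hset : {x : ℕ → Ω | s ≤ |(∑ i ∈ Finset.range N, f (x i)) / N - c|}
      ⊆ {x | s ≤ (∑ i ∈ Finset.range N, f (x i)) / N - c}
        ∪ {x | s ≤ (∑ i ∈ Finset.range N, -f (x i)) / N - -c} := by
    intro x hx
    simp only [Set.mem_setOf_eq, Set.mem_union] at hx ⊢
    rcases le_abs'.1 hx with h1 | h2
    · right
      rw [Finset.sum_neg_distrib, neg_div]
      linarith
    · left; exact h2
  calc P.real {x | s ≤ |(∑ i ∈ Finset.range N, f (x i)) / N - c|}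
      ≤ P.real ({x | s ≤ (∑ i ∈ Finset.range N, f (x i)) / N - c}
          ∪ {x | s ≤ (∑ i ∈ Finset.range N, -f (x i)) / N - -c}) := measureReal_mono hset
    _ ≤ P.real {x | s ≤ (∑ i ∈ Finset.range N, f (x i)) / N - c}
          + P.real {x | s ≤ (∑ i ∈ Finset.range N, -f (x i)) / N - -c} := measureReal_union_le _ _
    _ ≤ _ := by linarith

end Tail

/-! ### The `m`-skeleton: sup-norm decay, Poisson solution, Gaussian tails -/

section Skeleton

variable {κ : Kernel Ω Ω} [IsMarkovKernel κ] {μ₀ : Measure Ω} [IsProbabilityMeasure μ₀]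
  {π : Measure Ω} [IsProbabilityMeasure π] {ε : ℝ≥0∞} {m : ℕ}

omit [IsProbabilityMeasure μ₀] in
/-- **Skeleton sup-norm decay**: `(nHit κ m)(x, ·) ≥ ε π` (`ε > 0`), `π` invariant for `κ`, `f`
bounded measurable `π`-centred ⇒ `|(kop κ)^[t] f x| ≤ (1 − ε/2)^{⌊t/m⌋} C`. -/
theorem abs_iterate_kop_le_of_doeblin_nHit (hπ : Kernel.Invariant κ π)
    (hmin : ∀ x {B : Set Ω}, MeasurableSet B → ε * π B ≤ nHit κ m x B) (hε0 : 0 < ε)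
    {f : Ω → ℝ} (hf : Measurable f) {C : ℝ} (hC : ∀ x, |f x| ≤ C) (hf0 : ∫ x, f x ∂π = 0)
    (t : ℕ) (x : Ω) : |(kop κ)^[t] f x| ≤ (1 - (ε / 2).toReal) ^ (t / m) * C := by
  haveI := isMarkovKernel_nHit κ m
  obtain ⟨hrm, hrb⟩ := iterate_kop_bounded_measurable κ hf hC (t % m)
  have hr0 : ∫ y, (kop κ)^[t % m] f y ∂π = 0 := by rw [integral_iterate_kop κ hπ hf hC, hf0]
  have hlag : (kop κ)^[t] f = (kop (nHit κ m))^[t / m] ((kop κ)^[t % m] f) := by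
    conv_lhs => rw [← Nat.div_add_mod t m]
    rw [Function.iterate_add_apply, iterate_kop_nHit κ m hrm hrb (t / m)]
  rw [hlag]
  exact abs_iterate_kop_le_of_doeblin (κ := nHit κ m) (invariant_nHit hπ m) hmin hε0 hrm hrb hr0
    (t / m) x

omit [IsProbabilityMeasure μ₀] in
/-- **Poisson solution under an `m`-step Doeblin constant**: `|h| ≤ 2mC/ε`, `h − Kh = f`. -/
theorem poisson_exists_of_doeblin_nHit (hπ : Kernel.Invariant κ π)
    (hmin : ∀ x {B : Set Ω}, MeasurableSet B → ε * π B ≤ nHit κ m x B) (hm : 0 < m) (hε0 : 0 < ε)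
    {f : Ω → ℝ} (hf : Measurable f) {C : ℝ} (hC : ∀ x, |f x| ≤ C) (hf0 : ∫ x, f x ∂π = 0) :
    ∃ h : Ω → ℝ, Measurable h ∧ (∀ x, |h x| ≤ 2 * m * C / ε.toReal) ∧
      ∀ x, h x - kop κ h x = f x := by
  haveI := isMarkovKernel_nHit κ m
  obtain ⟨-, hl0, hl1, -, hr, hεr0⟩ := half_const_bounds hmin hε0
  have hC0 : 0 ≤ C := by
    obtain ⟨x⟩ := nonempty_of_isProbabilityMeasure π
    exact (abs_nonneg _).trans (hC x)
  have hsum : Summable fun t : ℕ => (1 - (ε / 2).toReal) ^ (t / m) * C :=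
    (summable_pow_div hm hl0 hl1).mul_right C
  obtain ⟨h, hh, hhb, hpois⟩ := poisson_exists_of_decay hf hC hsum
    (fun t x => abs_iterate_kop_le_of_doeblin_nHit hπ hmin hε0 hf hC hf0 t x)
  refine ⟨h, hh, fun x => (hhb x).trans ?_, hpois⟩
  rw [tsum_mul_right]
  have ht : (∑' t : ℕ, (1 - (ε / 2).toReal) ^ (t / m)) ≤ m / (ε.toReal / 2) :=
    calc (∑' t : ℕ, (1 - (ε / 2).toReal) ^ (t / m)) ≤ m / (1 - (1 - (ε / 2).toReal)) :=
          tsum_pow_div_le (x := 1 - (ε / 2).toReal) hm hl0 hl1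
      _ = m / (ε.toReal / 2) := by rw [sub_sub_cancel, hr]
  calc (∑' t : ℕ, (1 - (ε / 2).toReal) ^ (t / m)) * C ≤ (m / (ε.toReal / 2)) * C :=
        mul_le_mul_of_nonneg_right ht hC0
    _ = 2 * m * C / ε.toReal := by field_simp

/-- **HOEFFDING UNDER A BLOCK CERTIFICATE, ANY START.**  `π` invariant, `(nHit κ m)(x, ·) ≥ ε π`
(`ε > 0`, `m ≥ 1`), `|f| ≤ C`, `C' = C + |πf|`: for every initial law, `N ≥ 1`, `Ns ≥ 4mC'/ε`:
`P_{μ₀}(|(1/N) Σ_{i<N} f(X_i) − πf| ≥ s) ≤ 2 exp(−(Ns − 4mC'/ε)²/(8 N m² C'²/ε²))`. -/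
theorem chain_abs_tail_le_exp_of_doeblin_nHit (hπ : Kernel.Invariant κ π)
    (hmin : ∀ x {B : Set Ω}, MeasurableSet B → ε * π B ≤ nHit κ m x B) (hm : 0 < m) (hε0 : 0 < ε)
    {f : Ω → ℝ} (hf : Measurable f) {C : ℝ} (hC : ∀ x, |f x| ≤ C) {N : ℕ} (hN : N ≠ 0) {s : ℝ}
    (hs : 4 * m * (C + |∫ z, f z ∂π|) / ε.toReal ≤ N * s) :
    (Kernel.trajMeasure (X := fun _ : ℕ => Ω) μ₀
          (fun n : ℕ => κ.comap (fun y : (i : ↥(Finset.Iic n)) → Ω => y ⟨n, Finset.mem_Iic.2 le_rfl⟩)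
            (measurable_pi_apply _))).real
        {x | s ≤ |(∑ i ∈ Finset.range N, f (x i)) / N - ∫ z, f z ∂π|}
      ≤ 2 * Real.exp (-(N * s - 4 * m * (C + |∫ z, f z ∂π|) / ε.toReal) ^ 2
          / (8 * N * m ^ 2 * (C + |∫ z, f z ∂π|) ^ 2 / ε.toReal ^ 2)) := by
  haveI := isMarkovKernel_nHit κ m
  set c := ∫ z, f z ∂π with hc
  have hgm : Measurable (fun y => f y - c) := hf.sub measurable_const
  have hgb : ∀ y, |f y - c| ≤ C + |c| := fun y => (abs_sub _ _).trans (add_le_add (hC y) le_rfl)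
  have hg0 : ∫ y, (f y - c) ∂π = 0 := by
    rw [integral_sub (integrable_of_bounded π hf hC) (integrable_const _), integral_const,
      probReal_univ, one_smul, hc, sub_self]
  obtain ⟨h, hh, hhb, hpois⟩ := poisson_exists_of_doeblin_nHit hπ hmin hm hε0 hgm hgb hg0
  set B := 2 * m * (C + |c|) / ε.toReal with hB
  have hs' : 2 * B ≤ N * s := by
    rw [hB]
    have : 2 * (2 * m * (C + |c|) / ε.toReal) = 4 * m * (C + |c|) / ε.toReal := by ring
    linarith
  have ht := chain_abs_tail_le_exp_of_poisson κ μ₀ (c := c) hh hhb hpois hN hs'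
  have heq : -(N * s - 2 * B) ^ 2 / (2 * N * B ^ 2)
      = -(N * s - 4 * m * (C + |c|) / ε.toReal) ^ 2 / (8 * N * m ^ 2 * (C + |c|) ^ 2 / ε.toReal ^ 2) := by
    rw [hB, show 2 * (2 * m * (C + |c|) / ε.toReal) = 4 * m * (C + |c|) / ε.toReal by ring]
    congr 1
    field_simp
    ring
  rw [heq] at ht
  exact ht

end Skeleton

end Summit.Ventures.LatticeQCDFlow.Scoring

end
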